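import Summits.KontsevichZagierPeriods.KontsevichZagierPeriods.Theorems.SoloInformedAnyQuadratic
import HarnessLib
import HarnessLib.Audit

/-!
# SoloInformed — linear closure: sums of elementary integrands

Solo programme `solo-KontsevichZagierPeriods-informed`, session s112, file 35.

Rule (1b) (additivity in the integrand) makes span membership additive in the integrand: if
`f = Σᵢ fᵢ` on `D` and each `[D, fᵢ]` is an (absolutely convergent) representation lying in the span
of points and segments, then so is `[D, f]` (`soloInformed_segSpan_of_integrand_sum`, any
dimension).  Hence the elementary class of file 32 may be replaced by its additive closure
`SoloInformedIsKElementarySumOne` — integrands such as `√(1 − x²) + 1/√(x² + 2) + x^{1/3}/(1 + x)`,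
each summand absolutely integrable on `D` and elementary there — and THEOREM
`soloInformed_kzp_elementarySum`: **two absolutely convergent one-variable integrals whose integrands
are finite sums of elementary integrands (over `K = ℝ ∩ ℚ̄`, on arbitrary `ℚ`-semialgebraic domains)
and whose values agree are equivalent under the Kontsevich–Zagier rules.**  Unconditional.

References: M. Kontsevich, D. Zagier, *Periods* (2001), §1.2 rule (1); this work.
-/

noncomputable section

open scoped BigOperators Polynomial

namespace Summit.KontsevichZagierPeriods.KontsevichZagierPeriods.Theorems

open Set MeasureTheory
open Literature.ModelTheory.ExponentialFields
open Literature.NumberTheory.Transcendental Literature.NumberTheory.Transcendental.KZ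

/-! ## Additivity in the integrand -/

/-- `[D, f₁ + f₂] ≡ [D, f₁] + [D, f₂]`: span membership is additive in the integrand. -/
theorem soloInformed_segSpan_of_integrand_add {n : ℕ} (r r₁ r₂ : IntegralRep n)
    (h₁ : r₁.domain = r.domain) (h₂ : r₂.domain = r.domain)
    (hsum : EqOn r.integrand (r₁.integrand + r₂.integrand) r.domain)
    (hr₁ : of r₁ ∈ soloInformedSegSpan) (hr₂ : of r₂ ∈ soloInformedSegSpan) :
    of r ∈ soloInformedSegSpan := by
  have hrel : of r - of r₁ - of r₂ ∈ relations :=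
    integrandAddRel_subset_relations ⟨n, r, r₁, r₂, h₁, h₂, hsum, rfl⟩
  refine soloInformed_mem_segSpan_of_sub_mem (y := of r₁ + of r₂) ?_ (soloInformedSegSpan.add_mem hr₁ hr₂)
  rwa [← sub_sub]

/-- The difference representation `[D, f − g]` (for `g` a representation on the same domain). -/
def soloInformedSubRep {n : ℕ} (r r₁ : IntegralRep n) (h₁ : r₁.domain = r.domain) : IntegralRep n where
  domain := r.domain
  integrand := fun x => r.integrand x - r₁.integrand x
  isSemialgebraic_domain := r.isSemialgebraic_domain
  isSemialgebraicFunOn_integrand := by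
    have hg : IsSemialgebraicFunOn ℚ r.domain r₁.integrand :=
      r₁.isSemialgebraicFunOn_integrand.mono (fun x hx => by rw [h₁]; exact hx) r.isSemialgebraic_domain
    have hneg : IsSemialgebraicFunOn ℚ r.domain (fun x => (-1 : ℝ) * r₁.integrand x) :=
      (IsSemialgebraicFunOn.mul_holds (isSemialgebraicFunOn_const_of_isAlgebraic r.isSemialgebraic_domain
        (isAlgebraic_one.neg : IsAlgebraic ℚ (-1 : ℝ))) hg).congr fun _ _ => rfl
    exact (IsSemialgebraicFunOn.add_holds r.isSemialgebraicFunOn_integrand hneg).congr fun x _ => by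
      simp only [Pi.add_apply]; ring
  integrableOn := r.integrableOn.sub (r₁.integrableOn.mono_set (by rw [h₁]))

/-- **Finite sums:** if `f = Σ_{i ∈ s} fᵢ` on `D` and every `[D, fᵢ]` lies in the span, then `[D, f]`
lies in the span. -/
theorem soloInformed_segSpan_of_integrand_sum {n : ℕ} {ι : Type*} (s : Finset ι) :
    ∀ (r : IntegralRep n) (R : ι → IntegralRep n), (∀ i ∈ s, (R i).domain = r.domain) →
      EqOn r.integrand (fun x => ∑ i ∈ s, (R i).integrand x) r.domain →
      (∀ i ∈ s, of (R i) ∈ soloInformedSegSpan) → of r ∈ soloInformedSegSpan := by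
  classical
  induction s using Finset.induction_on with
  | empty =>
    intro r R _ hsum _
    exact soloInformed_relations_le_segSpan (soloInformed_of_mem_relations_of_integrand_zero r fun x hx => by
      rw [hsum hx]; exact Finset.sum_empty)
  | insert a s ha ih =>
    intro r R hdom hsum hmem
    have hda : (R a).domain = r.domain := hdom a (Finset.mem_insert_self a s)
    set r' := soloInformedSubRep r (R a) hda with hr'
    have h' : of r' ∈ soloInformedSegSpan :=
      ih r' R (fun i hi => (hdom i (Finset.mem_insert_of_mem hi)).trans rfl) (fun x hx => by
        show r.integrand x - (R a).integrand x = ∑ i ∈ s, (R i).integrand x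
        rw [hsum hx]
        show ∑ i ∈ insert a s, (R i).integrand x - (R a).integrand x = ∑ i ∈ s, (R i).integrand x
        rw [Finset.sum_insert ha, add_sub_cancel_left]) fun i hi =>
        hmem i (Finset.mem_insert_of_mem hi)
    exact soloInformed_segSpan_of_integrand_add r r' (R a) rfl hda (fun x _ => by
      show r.integrand x = (r.integrand x - (R a).integrand x) + (R a).integrand x
      ring) h' (hmem a (Finset.mem_insert_self a s))

/-! ## The additive closure of the elementary class -/

/-- `r = [D, f]` with `f = Σᵢ fᵢ` on `D`, each `[D, fᵢ]` an absolutely convergent representation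
whose integrand is elementary (file 32) or of the form `(A + B√(ax²+bx+c))/C` over `K` (file 34). -/
def SoloInformedIsKElementarySumOne (r : IntegralRep 1) : Prop :=
  ∃ (k : ℕ) (R : Fin k → IntegralRep 1), (∀ i, (R i).domain = r.domain) ∧
    (∀ i, SoloInformedIsKElementaryOne (R i) ∨
      ∃ (a b c : algebraicClosure ℚ ℝ) (A B C : (algebraicClosure ℚ ℝ)[X]),
        (∀ x ∈ (R i).domain, 0 ≤ algebraMap _ ℝ a * x 0 ^ 2 + algebraMap _ ℝ b * x 0 + algebraMap _ ℝ c) ∧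
        (∀ x ∈ (R i).domain, (Polynomial.aeval (x 0) C : ℝ) ≠ 0) ∧
        EqOn (R i).integrand (fun x => ((Polynomial.aeval (x 0) A : ℝ) + Polynomial.aeval (x 0) B *
          Real.sqrt (algebraMap _ ℝ a * x 0 ^ 2 + algebraMap _ ℝ b * x 0 + algebraMap _ ℝ c)) /
          Polynomial.aeval (x 0) C) (R i).domain) ∧
    EqOn r.integrand (fun x => ∑ i, (R i).integrand x) r.domain

/-- Elementary representations are elementary sums (`k = 1`). -/
theorem soloInformed_isKElementarySumOne_of_isKElementaryOne (r : IntegralRep 1)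
    (hr : SoloInformedIsKElementaryOne r) : SoloInformedIsKElementarySumOne r :=
  ⟨1, fun _ => r, fun _ => rfl, fun _ => Or.inl hr, fun x _ => by simp⟩

/-- Elementary sums lie in the span of points and segments. -/
theorem soloInformed_segSpan_of_isKElementarySumOne (r : IntegralRep 1)
    (hr : SoloInformedIsKElementarySumOne r) : of r ∈ soloInformedSegSpan := by
  obtain ⟨k, R, hdom, hcls, hsum⟩ := hr
  refine soloInformed_segSpan_of_integrand_sum Finset.univ r R (fun i _ => hdom i) hsum fun i _ => ?_
  rcases hcls i with h | ⟨a, b, c, A, B, C, hq, hC, hf⟩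
  · exact soloInformed_segSpan_of_isKElementaryOne _ h
  · exact soloInformed_segSpan_of_sqrt_anyQuadratic _ a b c A B C hq hC hf

/-- **The Kontsevich–Zagier period conjecture on the additive closure of the one-variable elementary
class.**  For `r, r'` of dimension `1` whose integrands are finite sums of elementary integrands
(`SoloInformedIsKElementarySumOne`): `value r = value r' → Equivalent r r'`; also against rational
representations of dimension `≤ 1` and every member of the span of points and segments.
Unconditional. [Kontsevich–Zagier 2001, §1.2 Question 1; this work] -/
theorem soloInformed_kzp_elementarySum (r r' : IntegralRep 1) (hr : SoloInformedIsKElementarySumOne r)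
    (hr' : SoloInformedIsKElementarySumOne r') :
    (r.value = r'.value → Equivalent r r') ∧
    (∀ {n : ℕ} (hn : n ≤ 1) (r₀ : IntegralRep n), r₀.IsRational → r.value = r₀.value →
      Equivalent r r₀) ∧
    (∀ {m : ℕ} (r₂ : IntegralRep m), of r₂ ∈ soloInformedSegSpan → r.value = r₂.value →
      Equivalent r r₂) := by
  have h := soloInformed_segSpan_of_isKElementarySumOne r hr
  exact ⟨fun hv => soloInformed_equivalent_of_mem_segSpan h
      (soloInformed_segSpan_of_isKElementarySumOne r' hr') hv,
    fun hn r₀ hr₀ hv => soloInformed_equivalent_of_mem_segSpan h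
      (soloInformed_of_mem_segSpan_of_isRational hn r₀ hr₀) hv,
    fun r₂ hr₂ hv => soloInformed_equivalent_of_mem_segSpan h hr₂ hv⟩

/-- Kernel form: an elementary sum of value `0` is a relation. -/
theorem soloInformed_mem_relations_of_value_eq_zero_elementarySum (r : IntegralRep 1)
    (hr : SoloInformedIsKElementarySumOne r) (h0 : r.value = 0) : of r ∈ relations :=
  soloInformed_mem_relations_of_mem_segSpan (soloInformed_segSpan_of_isKElementarySumOne r hr)
    (by rw [eval_of]; exact h0)

end Summit.KontsevichZagierPeriods.KontsevichZagierPeriods.Theorems
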